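import Mathlib
import Literature.Combinatorics.Optimization.MaxCutSheraliAdamsGap
import Literature.Combinatorics.Optimization.SignedMulticutCorrelations
import Literature.Combinatorics.Optimization.PseudoexpectationAsPseudoDensity
import HarnessLib

/-!
# The Charikar–Makarychev–Makarychev Sherali–Adams gap for MAX 2LIN(2) (Theorem 5.3 "not only for
# MAX CUT": edge weights `π_uv`, almost antipodal AND very close pairs) — PROVED, pointwise form

[topic Combinatorics/Optimization]

CMM09 Theorem 6.1 (Unique Games, p. 13) reduces to: "It is easy to see, that Theorem 5.3 works not only
for MAX CUT, but also for MAX 2LIN, we just need to substitute the metric `ρ^alt_µ` by the metric `ρ^π_µ`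
(here `π^s_uv` is the `s`-th coordinate of `π_uv`). The theorem guarantees that for every set `S` of size
at most `Ω(r)` there exists a distribution of cuts such that if `π^s_uv = 1`, then `u` and `v` lie on the
same side of the cut; and if `π^s_uv = −1`, then `u` and `v` lie on the opposite sides of the cut with
probability `1 − ε`."  Theorem 5.2 (p. 9): "the map `ψ_Y` sends adjacent vertices `u` and `v` to 'almost
antipodal' points if `π_uv = −1`: `‖ψ(u) − ψ(v)‖² = (4−µ)/(1+µ) = 2 − O(µ)`; and 'very close' points if
`π_uv = 1`: `‖ψ(u) − ψ(v)‖² = 3µ/(1+µ) = O(√µ)`."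

This file carries out that substitution on the tree's MAX-CUT formalisation
(`GaussianSignRounding`, `SheraliAdamsGapFromLocalKernels`, `MaxCutSheraliAdamsGap`), with the signed
correlation kernel of `SignedMulticutCorrelations`:

* `GaussianSignRounding.measure_diffSide_le` — **very close points are almost never separated**: if
  `K_uu = K_vv = 1`, `K_uv ≥ 1 − δ`, `δ ≤ ε³/16`, then `Pr[u, v separated] ≤ ε` (mirror of
  `measure_sameSide_le`: anti-concentration of `Z_u` plus Chebyshev for `Z_u − Z_v`, variance
  `2 − 2K_uv ≤ 2δ`); `L_sameSide_ge`, `saE_eqn_ge` (the Sherali–Adams value of the equation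
  `x_v = x_u ⊕ σ` of an edge with `K_uv ≤ −1 + δ` (`σ = 1`) resp. `K_uv ≥ 1 − δ` (`σ = 0`) is `≥ 1 − ε`);
  `cmmKernel_ge_of_edge` (`F ≥ 1 − µ ⇒ K ≥ 1 − 5µ/2`, "very close");
* `exists_pseudoDensity_twoLin_of_localCorrelations` — **Thm 5.3 for MAX 2LIN minus the graph
  theory**: a symmetric unit-diagonal target `F` with `F ≤ −1 + µ` on the `π = −1` edges and
  `F ≥ 1 − µ` on the `π = +1` edges, locally `η`-approximated by PSD matrices on all `≤ d`-sets
  (`dη ≤ µ/2`, `40µ ≤ ε³`), yields a `d`-local pseudo-density (Lee–Raghavendra–Steurer currency, via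
  `PseudoexpectationAsPseudoDensity`) giving every edge equation `x_v = x_u ⊕ [π_uv = −1]` pseudo-probability
  `≥ 1 − ε`;
* `Multicut.cmmTargetS` (`F(u,v) = π_uv (1−µ)^{d(u,v)}·[d(u,v) ≤ L]`, the Gram form of `ρ^π_µ`
  truncated at `L`), `cmm_hlocS` (the local PSD approximants from the signed multicut process on the
  local edge sets, as `cmm_hloc`), and **`exists_pseudoDensity_twoLin_of_gapGraph`** — the pointwise
  signed Theorem 5.3: a loopless edge set of maximum degree `∆`, `l`-path-decomposable on `≤ √n`-vertex
  sub-edge-sets and with all cycles longer than `2L`, with ANY edge weights `π`, admits for fitting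
  parameters a `d`-local pseudo-density under which every edge equation has pseudo-probability `≥ 1 − ε`.

Everything is proved; no named facts.

## References

* [CharikarMakarychevMakarychev2009] M. Charikar, K. Makarychev, Y. Makarychev, *Integrality gaps for
  Sherali–Adams relaxations*, STOC 2009, doi:10.1145/1536414.1536455; §5 p. 8 (`π_uv`, `ρ^π_µ`),
  Cor. 5.1 (p. 8–9), Thm 5.2 (p. 9–10), Thm 5.3 (p. 11), Thm 6.1 proof sketch (p. 13).  Held text
  `paper:doi-10-1145-1536414-1536455`.
* [LeeRaghavendraSteurer2015] J. R. Lee, P. Raghavendra, D. Steurer, *Lower bounds on the size of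
  semidefinite programming relaxations*, STOC 2015 / arXiv:1411.6317, §7.1 (`d`-local pseudo-densities).
-/

noncomputable section

open MeasureTheory ProbabilityTheory Finset Matrix Set
open scoped ENNReal NNReal

namespace Literature.Combinatorics.Optimization

/-! ### Very close points are almost never separated -/

namespace GaussianSignRounding

variable {n : ℕ} (K : Matrix (Fin n) (Fin n) ℝ)

section Pair

variable {T : Finset (Fin n)} (u v : ↥T)

/-- If `u, v` are on different sides and `|z_u| ≥ t` then `|z_u − z_v| ≥ t`: the different-side event
is covered by `{|z_u| < t} ∪ {|z_u − z_v| ≥ t}`. [cite: CharikarMakarychevMakarychev2009, Thm 5.2 (p. 9: "very close points if π_uv = 1") and Thm 6.1 proof (p. 13)] -/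
theorem diffSide_subset (t : ℝ) :
    (sameSide u v)ᶜ ⊆ {z | |z u| < t} ∪ {z | t ≤ |z u - z v|} := by
  intro z hz
  simp only [sameSide, mem_compl_iff, mem_setOf_eq, decide_eq_decide] at hz
  by_cases ht : |z u| < t
  · exact Or.inl ht
  · right
    simp only [mem_setOf_eq, not_lt] at ht ⊢
    refine ht.trans ?_
    by_cases hu : 0 ≤ z u
    · have hv : ¬ 0 ≤ z v := fun hv => hz ⟨fun _ => hv, fun _ => hu⟩
      push Not at hv
      rw [abs_of_nonneg hu, abs_of_nonneg (by linarith)]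
      linarith
    · have hv : 0 ≤ z v := by
        by_contra hv
        exact hz ⟨fun h => absurd h hu, fun h => absurd h hv⟩
      push Not at hu
      rw [abs_of_neg hu, abs_of_nonpos (by linarith)]
      linarith

/-- **Chebyshev for `Z_u − Z_v`**: if `K_uu = K_vv = 1` and `K_uv ≥ 1 − δ` then
`Pr[|Z_u − Z_v| ≥ t] ≤ 2δ/t²` (`Var(Z_u − Z_v) = 2 − 2K_uv ≤ 2δ`).
[cite: CharikarMakarychevMakarychev2009, Thm 5.2 (p. 9: "‖ψ(u) − ψ(v)‖² = 3µ/(1+µ)") and Thm 6.1 proof (p. 13)] -/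
theorem measure_abs_sub_ge_le (hT : (localCov K T).PosSemidef) (huu : K u u = 1) (hvv : K v v = 1)
    {δ : ℝ} (huv : 1 - δ ≤ K u v) {t : ℝ} (ht : 0 < t) :
    (gauss K T) {z | t ≤ |z u - z v|} ≤ ENNReal.ofReal (2 * δ / t ^ 2) := by
  have hmu : MemLp (fun z : EuclideanSpace ℝ ↥T => z u) 2 (gauss K T) := by
    have := IsGaussian.memLp_dual (gauss K T) (EuclideanSpace.proj u) 2 (by norm_num)
    unfold gauss at this ⊢; simpa using this
  have hmv : MemLp (fun z : EuclideanSpace ℝ ↥T => z v) 2 (gauss K T) := by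
    have := IsGaussian.memLp_dual (gauss K T) (EuclideanSpace.proj v) 2 (by norm_num)
    unfold gauss at this ⊢; simpa using this
  have hi : ∀ i : ↥T, ∫ z, (z : EuclideanSpace ℝ ↥T) i ∂(gauss K T) = 0 := by
    intro i
    have := (EuclideanSpace.proj (𝕜 := ℝ) i).integral_comp_comm
      (IsGaussian.integrable_id (μ := gauss K T))
    simp only [EuclideanSpace.coe_proj, id_eq] at this
    rw [this]
    unfold gauss
    rw [integral_id_multivariateGaussian]
    rfl
  have hmean : (gauss K T)[fun z : EuclideanSpace ℝ ↥T => z u - z v] = 0 := by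
    rw [integral_sub (hmu.integrable (by norm_num)) (hmv.integrable (by norm_num)), hi u, hi v, sub_zero]
  have hvar : Var[fun z : EuclideanSpace ℝ ↥T => z u - z v; gauss K T] = K u u - 2 * K u v + K v v := by
    rw [variance_fun_sub hmu hmv]
    unfold gauss
    rw [variance_eval_multivariateGaussian hT, variance_eval_multivariateGaussian hT,
      covariance_eval_multivariateGaussian hT]
    rfl
  have hm : MemLp (fun z : EuclideanSpace ℝ ↥T => z u - z v) 2 (gauss K T) := hmu.sub hmv
  have hcheb := meas_ge_le_variance_div_sq hm ht
  rw [hmean] at hcheb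
  simp only [sub_zero] at hcheb
  refine hcheb.trans (ENNReal.ofReal_le_ofReal (div_le_div_of_nonneg_right ?_ (by positivity)))
  rw [hvar, huu, hvv]
  linarith

/-- **Very close points are separated almost never**: if `K_uu = K_vv = 1`, `K_uv ≥ 1 − δ` and
`δ ≤ ε³/16` (`0 < ε`), then `Pr[u, v on different sides] ≤ ε` (take `t = ε/2`).  This replaces the
printed `‖ψ(u) − ψ(v)‖ = O(√µ)`. [cite: CharikarMakarychevMakarychev2009, Thm 5.2 (p. 9) and Thm 6.1 proof (p. 13: "if π^s_uv = 1, then u and v lie on the same side of the cut")] -/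
theorem measure_diffSide_le (hT : (localCov K T).PosSemidef) (huu : K u u = 1) (hvv : K v v = 1)
    {δ ε : ℝ} (huv : 1 - δ ≤ K u v) (hε : 0 < ε) (hδ : δ ≤ ε ^ 3 / 16) :
    ((gauss K T) (sameSide u v)ᶜ).toReal ≤ ε := by
  wlog hδ0 : 0 ≤ δ generalizing δ
  · exact this (le_trans (by gcongr; exact le_max_left δ 0) huv) (max_le hδ (by positivity))
      (le_max_right δ 0)
  have ht : (0 : ℝ) < ε / 2 := by positivity
  calc ((gauss K T) (sameSide u v)ᶜ).toReal
      ≤ ((gauss K T) ({z | |z u| < ε / 2} ∪ {z | ε / 2 ≤ |z u - z v|})).toReal :=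
        ENNReal.toReal_mono (measure_ne_top _ _) (measure_mono (diffSide_subset u v (ε / 2)))
    _ ≤ ((gauss K T) {z | |z u| < ε / 2}).toReal + ((gauss K T) {z | ε / 2 ≤ |z u - z v|}).toReal := by
        rw [← ENNReal.toReal_add (measure_ne_top _ _) (measure_ne_top _ _)]
        exact ENNReal.toReal_mono (by simp [measure_ne_top]) (measure_union_le _ _)
    _ ≤ ε / 2 + 2 * δ / (ε / 2) ^ 2 := by
        gcongr
        · calc ((gauss K T) {z | |z u| < ε / 2}).toReal ≤ (ENNReal.ofReal (ε / 2)).toReal :=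
                ENNReal.toReal_mono ENNReal.ofReal_ne_top (measure_abs_lt_le K u hT huu (ε / 2))
            _ = ε / 2 := ENNReal.toReal_ofReal ht.le
        · calc ((gauss K T) {z | ε / 2 ≤ |z u - z v|}).toReal
              ≤ (ENNReal.ofReal (2 * δ / (ε / 2) ^ 2)).toReal :=
                ENNReal.toReal_mono ENNReal.ofReal_ne_top (measure_abs_sub_ge_le K u v hT huu hvv huv ht)
            _ = 2 * δ / (ε / 2) ^ 2 := ENNReal.toReal_ofReal (by positivity)
    _ ≤ ε / 2 + ε / 2 := by
        have h3 : 2 * δ / (ε / 2) ^ 2 ≤ ε / 2 := by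
          rw [div_le_iff₀ (by positivity)]
          nlinarith
        linarith
    _ = ε := by ring

/-- The different-side event in terms of sign patterns. [cite: CharikarMakarychevMakarychev2009, Thm 3.1 proof (p. 6)] -/
theorem diffSide_eq_preimage : (sameSide u v)ᶜ =
    signPattern ⁻¹' ((univ.filter fun b : ↥T → Bool => b u ≠ b v : Finset (↥T → Bool)) : Set (↥T → Bool)) := by
  ext z
  simp [sameSide, signPattern]

/-- **The local probability that a very close pair lies on the same side is close to `1`**:
`L_T(𝟙[b_u = b_v]) ≥ 1 − ε` under the hypotheses of `measure_diffSide_le`.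
[cite: CharikarMakarychevMakarychev2009, Thm 6.1 proof (p. 13: "if π^s_uv = 1, then u and v lie on the same side")] -/
theorem L_sameSide_ge (hT : (localCov K T).PosSemidef) (huu : K u u = 1) (hvv : K v v = 1)
    {δ ε : ℝ} (huv : 1 - δ ≤ K u v) (hε : 0 < ε) (hδ : δ ≤ ε ^ 3 / 16) :
    1 - ε ≤ L K T (fun b => if b u = b v then 1 else 0) := by
  have hdiff : L K T (fun b => if b u ≠ b v then (1 : ℝ) else 0) ≤ ε := by
    have := L_indicator K T (univ.filter fun b : ↥T → Bool => b u ≠ b v)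
    simp only [mem_filter, Finset.mem_univ, true_and] at this
    rw [this, ← diffSide_eq_preimage]
    exact measure_diffSide_le K u v hT huu hvv huv hε hδ
  have hsplit : L K T (fun b => if b u = b v then (1 : ℝ) else 0) =
      L K T (fun _ => 1) - L K T (fun b => if b u ≠ b v then (1 : ℝ) else 0) := by
    rw [← map_sub]
    congr 1
    funext b
    by_cases h : b u = b v <;> simp [h]
  rw [hsplit, L_one]
  linarith

end Pair

/-! ### The Sherali–Adams value of an edge equation -/

/-- The equation indicator `𝟙[x_v = x_u ⊕ σ]` of an edge depends only on the coordinates `u, v`.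
[cite: CharikarMakarychevMakarychev2009, Thm 6.1 proof (p. 13: "an instance of MAX 2LIN mod 2")] -/
theorem eqnFn_dependsOn (σ : Bool) (u v : Fin n) (x y : Fin n → Bool)
    (h : ∀ i ∈ ({u, v} : Finset (Fin n)), x i = y i) :
    (if x v = xor (x u) σ then (1 : ℝ) else 0) = (if y v = xor (y u) σ then (1 : ℝ) else 0) := by
  rw [h u (by simp), h v (by simp)]

/-- **The Sherali–Adams value of the equation `x_v = x_u ⊕ σ` of an edge is `≥ 1 − ε`** for the
Gaussian sign rounding of a kernel with PSD `≤ d`-minors (`d ≥ 2`, `K_uu = K_vv = 1`), provided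
`K_uv ≤ −1 + δ` when `σ = 1` ("opposite sides") and `K_uv ≥ 1 − δ` when `σ = 0` ("same side"),
`δ ≤ ε³/16`. [cite: CharikarMakarychevMakarychev2009, Thm 3.1 (p. 6), Thm 5.2 (p. 9) and Thm 6.1 proof (p. 13)] -/
theorem saE_eqn_ge {d : ℕ} (hK : ∀ T : Finset (Fin n), T.card ≤ d → (localCov K T).PosSemidef)
    (hd : 2 ≤ d) {u v : Fin n} (huv0 : u ≠ v) (huu : K u u = 1) (hvv : K v v = 1) (σ : Bool)
    {δ ε : ℝ} (huv : if σ then K u v ≤ -1 + δ else 1 - δ ≤ K u v) (hε : 0 < ε) (hδ : δ ≤ ε ^ 3 / 16) :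
    1 - ε ≤ (localExpectations K d hK).saE (fun x => if x v = xor (x u) σ then (1 : ℝ) else 0) := by
  classical
  set T : Finset (Fin n) := {u, v} with hTdef
  have hT : T.card ≤ d := by
    rw [hTdef, card_pair huv0]; exact hd
  rw [(localExpectations K d hK).saE_eq_of_dependsOn hT (eqnFn_dependsOn σ u v), localExpectations_L]
  have hu : u ∈ T := by simp [hTdef]
  have hv : v ∈ T := by simp [hTdef]
  cases σ with
  | true =>
    simp only [if_true] at huv
    have key := L_separated_ge K (T := T) ⟨u, hu⟩ ⟨v, hv⟩ (hK T hT) huu hvv huv hε hδ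
    convert key using 2
    funext b
    have h1 : LocalExpectations.extend T b v = b ⟨v, hv⟩ := LocalExpectations.extend_apply_mem T b ⟨v, hv⟩
    have h2 : LocalExpectations.extend T b u = b ⟨u, hu⟩ := LocalExpectations.extend_apply_mem T b ⟨u, hu⟩
    rw [h1, h2]
    cases b ⟨u, hu⟩ <;> cases b ⟨v, hv⟩ <;> simp
  | false =>
    simp only [Bool.false_eq_true, if_false] at huv
    have key := L_sameSide_ge K (T := T) ⟨u, hu⟩ ⟨v, hv⟩ (hK T hT) huu hvv huv hε hδ
    convert key using 2
    funext b
    have h1 : LocalExpectations.extend T b v = b ⟨v, hv⟩ := LocalExpectations.extend_apply_mem T b ⟨v, hv⟩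
    have h2 : LocalExpectations.extend T b u = b ⟨u, hu⟩ := LocalExpectations.extend_apply_mem T b ⟨u, hu⟩
    rw [h1, h2]
    cases b ⟨u, hu⟩ <;> cases b ⟨v, hv⟩ <;> simp

/-- **"Very close" edges**: `F(u,v) ≥ 1 − µ` gives `K(u,v) ≥ 1 − 5µ/2` for the corrected kernel.
[cite: CharikarMakarychevMakarychev2009, Thm 5.2 (p. 9: "‘very close’ points if π_uv = 1: ‖ψ(u) − ψ(v)‖² = 3µ/(1+µ)")] -/
theorem cmmKernel_ge_of_edge {F : Matrix (Fin n) (Fin n) ℝ} {μ : ℝ} (hμ : 0 ≤ μ) {u v : Fin n}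
    (huv : u ≠ v) (hF : 1 - μ ≤ F u v) : 1 - 5 * μ / 2 ≤ cmmKernel F μ u v := by
  rw [cmmKernel, if_neg huv, add_zero, le_div_iff₀ (by positivity)]
  nlinarith

/-! ### Theorem 5.3 for MAX 2LIN minus the graph theory -/

/-- **CMM Theorem 5.3 for MAX 2LIN(2), minus the graph theory, in pseudo-density form.**  Let `F` be a
symmetric target correlation with unit diagonal on `[n]` and `π : Sym2 [n] → Bool` edge weights
(`true` = `−1`) on a set `E` of edges, with `F(u,v) ≤ −1 + µ` on the weight-`−1` edges and
`F(u,v) ≥ 1 − µ` on the weight-`+1` edges (`µ ≥ 0`); suppose every `T ⊆ [n]` with `|T| ≤ d` (`d ≥ 2`)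
carries a positive semidefinite matrix entrywise `η`-close to `F|_T` (`η ≥ 0`, `dη ≤ µ/2`), and
`40µ ≤ ε³`.  Then there is a `d`-local pseudo-density (uniform measure on `{0,1}ⁿ`) under which every
edge equation `x_v = x_u ⊕ π_uv` has pseudo-probability `≥ 1 − ε` — the Gaussian sign rounding of the
corrected kernel (Thm 5.2 + Thm 3.1 + Lemma 2.1), read as a pseudo-density.
[cite: CharikarMakarychevMakarychev2009, Thm 5.3 (p. 11) with Thm 5.2 (p. 9–10), Thm 3.1 (p. 6) and Thm 6.1 proof (p. 13); LeeRaghavendraSteurer2015, §7.1 (arXiv p. 27)] -/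
theorem exists_pseudoDensity_twoLin_of_localCorrelations (E : Finset (Sym2 (Fin n)))
    (hloop : ∀ e ∈ E, ¬ e.IsDiag) (π : Sym2 (Fin n) → Bool)
    (F : Matrix (Fin n) (Fin n) ℝ) (hFsymm : ∀ u v, F u v = F v u) (hFdiag : ∀ u, F u u = 1)
    {μ η ε : ℝ} (hμ : 0 ≤ μ) (hη0 : 0 ≤ η) (hε : 0 < ε) (hμε : 40 * μ ≤ ε ^ 3)
    (hedge : ∀ u v : Fin n, s(u, v) ∈ E →
      if π s(u, v) then F u v ≤ -1 + μ else 1 - μ ≤ F u v)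
    {d : ℕ} (hd : 2 ≤ d) (hη : (d : ℝ) * η ≤ μ / 2)
    (hloc : ∀ T : Finset (Fin n), T.card ≤ d →
      ∃ P : Matrix ↥T ↥T ℝ, P.PosSemidef ∧ ∀ i j : ↥T, |P i j - F i j| ≤ η) :
    ∃ D : (Fin n → Bool) → ℝ, IsLocalPseudoDensity (uniformWeight (Fin n) Bool) d D ∧
      ∀ u v : Fin n, s(u, v) ∈ E → 1 - ε ≤ muExpect (uniformWeight (Fin n) Bool)
        (fun y => D y * (if y v = xor (y u) (π s(u, v)) then (1 : ℝ) else 0)) := by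
  -- the corrected kernel and its local positive semidefiniteness (Thm 5.2)
  set K := cmmKernel F μ with hKdef
  have hK : ∀ T : Finset (Fin n), T.card ≤ d → (localCov K T).PosSemidef := by
    intro T hT
    obtain ⟨P, hP, hPF⟩ := hloc T hT
    refine posSemidef_localCov_cmmKernel hFsymm hμ hη0 T P hP hPF (le_trans ?_ hη)
    exact mul_le_mul_of_nonneg_right (by exact_mod_cast hT) hη0
  -- Thm 3.1 + Lemma 2.1: the pseudoexpectation; read it as a pseudo-density
  set pE := (localExpectations K d hK).toSA with hpE
  refine ⟨pE.density, pE.isLocalPseudoDensity_density, fun u v he => ?_⟩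
  rw [SAPseudoexpectation.muExpect_density_mul, hpE, LocalExpectations.toSA_E]
  have huv : u ≠ v := fun h => hloop _ he (by subst h; exact Sym2.mk_isDiag_iff.2 rfl)
  refine saE_eqn_ge K hK hd huv (cmmKernel_diag hFdiag hμ u) (cmmKernel_diag hFdiag hμ v) (π s(u, v))
    (δ := 5 * μ / 2) ?_ hε (by nlinarith)
  have h := hedge u v he
  by_cases hπ : π s(u, v) = true
  · rw [if_pos hπ] at h ⊢
    exact cmmKernel_le_of_edge hμ huv h
  · rw [if_neg hπ] at h ⊢
    exact cmmKernel_ge_of_edge hμ huv h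

end GaussianSignRounding

/-! ### The signed target kernel and the local positive semidefinite approximants -/

namespace Multicut

section Hereditary

variable {V : Type*} (π : Sym2 V → Bool)

/-- Weight consistency is inherited by sub-edge-sets. [cite: CharikarMakarychevMakarychev2009, §5 (p. 8)] -/
theorem SignConsistent.mono {A E : Finset (Sym2 V)} (hAE : A ⊆ E) {L : ℕ}
    (hU : SignConsistent π E L) : SignConsistent π A L := by
  intro u v p q hp hq hpL hqL
  have hpE : ∀ e ∈ p.edges, e ∈ (gr E).edgeSet := fun e he =>
    SimpleGraph.edgeSet_mono (gr_mono hAE) (p.edges_subset_edgeSet he)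
  have hqE : ∀ e ∈ q.edges, e ∈ (gr E).edgeSet := fun e he =>
    SimpleGraph.edgeSet_mono (gr_mono hAE) (q.edges_subset_edgeSet he)
  rw [wsign_eq_of_edges_eq π (p.edges_transfer hpE).symm, wsign_eq_of_edges_eq π (q.edges_transfer hqE).symm]
  exact hU _ _ (hp.transfer hpE) (hq.transfer hqE) (by rw [SimpleGraph.Walk.length_transfer]; exact hpL)
    (by rw [SimpleGraph.Walk.length_transfer]; exact hqL)

/-- `π_uv` computed in a sub-edge-set realising the distance `d_E(u,v) ≤ L` agrees with `π_uv` in `E`.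
[cite: CharikarMakarychevMakarychev2009, Thm 5.2 proof (p. 9: "all distances … do not depend on whether we define them with respect to the shortest path metric in G or … in B_d(Y, l)")] -/
theorem psgn_eq_of_subset {A E : Finset (Sym2 V)} (hAE : A ⊆ E) {L : ℕ} (hU : SignConsistent π E L)
    {u v : V} {k : ℕ} (hkE : (gr E).edist u v = k) (hkA : (gr A).edist u v = k) (hkL : k ≤ L) :
    psgn π A u v = psgn π E u v := by
  have hrA : (gr A).Reachable u v :=
    SimpleGraph.edist_ne_top_iff_reachable.1 (by rw [hkA]; exact ENat.coe_ne_top k)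
  have hdA : (gr A).dist u v = k := by
    have := SimpleGraph.Reachable.coe_dist_eq_edist hrA
    rw [hkA] at this; exact_mod_cast this
  have hrE : (gr E).Reachable u v :=
    SimpleGraph.edist_ne_top_iff_reachable.1 (by rw [hkE]; exact ENat.coe_ne_top k)
  have hdE : (gr E).dist u v = k := by
    have := SimpleGraph.Reachable.coe_dist_eq_edist hrE
    rw [hkE] at this; exact_mod_cast this
  obtain ⟨P, hP, hPlen, hpsgn⟩ := psgn_spec π hrA
  have hPE : ∀ e ∈ P.edges, e ∈ (gr E).edgeSet := fun e he =>
    SimpleGraph.edgeSet_mono (gr_mono hAE) (P.edges_subset_edgeSet he)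
  rw [hpsgn, wsign_eq_of_edges_eq π (P.edges_transfer hPE).symm]
  refine (psgn_eq_wsign π hU _ (hP.transfer hPE) ?_ ?_).symm
  · rw [SimpleGraph.Walk.length_transfer, hPlen, hdA, hdE]
  · rw [SimpleGraph.Walk.length_transfer, hPlen, hdA]; exact hkL

end Hereditary

open GaussianSignRounding

variable {n : ℕ} (π : Sym2 (Fin n) → Bool)

open Classical in
/-- **The signed target correlation kernel** `F(u,v) = π_uv (1−µ)^{d_G(u,v)}·[d_G(u,v) ≤ L]` (the Gram
form `1 − 2ρ^π_µ` of the metric `ρ^π_µ`, truncated at `L`).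
[cite: CharikarMakarychevMakarychev2009, §5 (p. 8: "ρ^π_µ(u,v) = (1 − (1−µ)^{d(u,v)} π_uv)/2") and Thm 5.2 proof (p. 9–10)] -/
def cmmTargetS (E : Finset (Sym2 (Fin n))) (μ : ℝ) (L : ℕ) : Matrix (Fin n) (Fin n) ℝ := fun u v =>
  if (gr E).edist u v ≤ (L : ℕ∞) then psgn π E u v * (1 - μ) ^ (gr E).dist u v else 0

/-- `F` is symmetric (under weight consistency). [cite: CharikarMakarychevMakarychev2009, Thm 5.2 proof (p. 9–10)] -/
theorem cmmTargetS_symm {E : Finset (Sym2 (Fin n))} (μ : ℝ) {L : ℕ} (hU : SignConsistent π E L)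
    (u v : Fin n) : cmmTargetS π E μ L u v = cmmTargetS π E μ L v u := by
  unfold cmmTargetS
  by_cases h : (gr E).edist u v ≤ (L : ℕ∞)
  · have h' : (gr E).edist v u ≤ (L : ℕ∞) := by rw [SimpleGraph.edist_comm]; exact h
    rw [if_pos h, if_pos h', psgn_comm π hU h, SimpleGraph.dist_comm]
  · have h' : ¬ (gr E).edist v u ≤ (L : ℕ∞) := by rw [SimpleGraph.edist_comm]; exact h
    rw [if_neg h, if_neg h']

/-- `F(u,u) = 1`. [cite: CharikarMakarychevMakarychev2009, Thm 5.2 proof (p. 9–10)] -/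
theorem cmmTargetS_diag (E : Finset (Sym2 (Fin n))) (μ : ℝ) (L : ℕ) (u : Fin n) :
    cmmTargetS π E μ L u u = 1 := by
  unfold cmmTargetS
  rw [SimpleGraph.edist_self, SimpleGraph.dist_self, pow_zero, psgn_self, mul_one,
    if_pos (show (0 : ℕ∞) ≤ L from bot_le)]

/-- On an edge `F = π_uv (1 − µ)`: `−1 + µ` on the weight-`−1` edges, `1 − µ` on the weight-`+1` edges
(for `L ≥ 1`, under weight consistency). [cite: CharikarMakarychevMakarychev2009, §5 (p. 8: "the length of the edge (u, v) will be equal to (1 − (1 − µ)π_uv)/2")] -/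
theorem cmmTargetS_edge {E : Finset (Sym2 (Fin n))} (μ : ℝ) {L : ℕ} (hU : SignConsistent π E L)
    (hL : 1 ≤ L) {u v : Fin n} (huv : s(u, v) ∈ E) (hne : u ≠ v) :
    if π s(u, v) then cmmTargetS π E μ L u v ≤ -1 + μ else 1 - μ ≤ cmmTargetS π E μ L u v := by
  have hadj : (gr E).Adj u v := gr_adj.2 ⟨huv, hne⟩
  have hval : cmmTargetS π E μ L u v = esgn π s(u, v) * (1 - μ) := by
    unfold cmmTargetS
    rw [SimpleGraph.edist_eq_one_iff_adj.2 hadj, SimpleGraph.dist_eq_one_iff_adj.2 hadj, pow_one,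
      if_pos (by exact_mod_cast hL), psgn_of_adj π hU hL hadj]
  rw [hval]
  unfold esgn
  by_cases hπ : π s(u, v) = true
  · rw [if_pos hπ, if_pos hπ]; linarith
  · rw [if_neg hπ, if_neg hπ]; linarith

/-- **The local step of the signed Thm 5.3**: if every sub-edge-set of `E` on `≤ √n` vertices is
`l`-path decomposable, `9L ≤ l`, `(1−µ)^L ≤ 1/2`, `d(∆+1)^L ≤ √n`, and weights are consistent up to
`L`, then for every `T` with `|T| ≤ d` the signed correlation kernel of the good multicut distribution
of the local edge set `localEdges E T L` is a positive semidefinite matrix on `T` entrywise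
`(1−µ)^L`-close to `F`. [cite: CharikarMakarychevMakarychev2009, Thm 5.3 proof (p. 11) with Cor. 5.1 (p. 8–9), Thm 5.2 proof (p. 9–10) and Thm 6.1 proof (p. 13)] -/
theorem cmm_hlocS (E : Finset (Sym2 (Fin n))) (hloop : ∀ e ∈ E, ¬ e.IsDiag) {Δ : ℕ}
    (hΔ : ∀ v : Fin n, (E.filter fun e => v ∈ e).card ≤ Δ) {μ : ℝ} (hμ0 : 0 ≤ μ) (hμ1 : μ ≤ 1)
    {L l : ℕ} (hq : (1 - μ) ^ L ≤ 1 / 2) (hl : 9 * L ≤ l)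
    (hPD : ∀ E' ⊆ E, ((supp E').card : ℝ) ^ 2 ≤ n → PathDecomposable l E')
    (hU : SignConsistent π E L)
    {d : ℕ} (hfit : ((d * (Δ + 1) ^ L : ℕ) : ℝ) ^ 2 ≤ n) :
    ∀ T : Finset (Fin n), T.card ≤ d → ∃ P : Matrix ↥T ↥T ℝ, P.PosSemidef ∧
      ∀ i j : ↥T, |P i j - cmmTargetS π E μ L i j| ≤ (1 - μ) ^ L := by
  intro T hT
  set ET := localEdges E T L with hET
  have hcard : ((supp ET).card : ℝ) ^ 2 ≤ n := by
    have h1 : (supp ET).card ≤ d * (Δ + 1) ^ L :=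
      (Finset.card_le_card (supp_localEdges_subset E T L)).trans
        ((card_ball_le E hΔ T L).trans (Nat.mul_le_mul_right _ hT))
    refine le_trans ?_ hfit
    have : ((supp ET).card : ℝ) ≤ ((d * (Δ + 1) ^ L : ℕ) : ℝ) := by exact_mod_cast h1
    exact pow_le_pow_left₀ (Nat.cast_nonneg _) this 2
  have hPD' : PathDecomposable l ET := hPD ET (localEdges_subset E T L) hcard
  have hloop' : ∀ e ∈ ET, ¬ e.IsDiag := fun e he => hloop e (localEdges_subset E T L he)
  have hU' : SignConsistent π ET L := hU.mono π (localEdges_subset E T L)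
  obtain ⟨p, hG⟩ := exists_goodMulticut hμ0 hμ1 hq hl ET hPD' hloop'
  refine ⟨Matrix.of fun i j : ↥T => corrS π p ET i.1 j.1, corrS_posSemidef π hG.nonneg ET T, fun i j => ?_⟩
  simp only [Matrix.of_apply]
  have h1μ : 0 ≤ 1 - μ := by linarith
  by_cases hnear : (gr E).edist i.1 j.1 ≤ (L : ℕ∞)
  · -- near pairs: exact agreement
    obtain ⟨k, hk⟩ := ENat.ne_top_iff_exists.1 (ne_top_of_le_ne_top (ENat.coe_ne_top L) hnear)
    have hkL : k ≤ L := by rw [← hk] at hnear; exact_mod_cast hnear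
    have hloc : (gr ET).edist i.1 j.1 = k := edist_localEdges_eq i.2 hk.symm hkL
    have hdist : (gr E).dist i.1 j.1 = k := by
      have hr : (gr E).Reachable i.1 j.1 :=
        SimpleGraph.edist_ne_top_iff_reachable.1 (by rw [← hk]; exact ENat.coe_ne_top k)
      have := SimpleGraph.Reachable.coe_dist_eq_edist hr
      rw [← hk] at this
      exact_mod_cast this
    rw [corrS_eq_of_edist_le π hG hU' hloc hkL, psgn_eq_of_subset π (localEdges_subset E T L) hU hk.symm hloc hkL,
      cmmTargetS, if_pos hnear, hdist, sub_self, abs_zero]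
    exact pow_nonneg h1μ L
  · -- far pairs: `F = 0`, `|corr| ≤ (1−µ)^L`
    rw [cmmTargetS, if_neg hnear, sub_zero]
    exact abs_corrS_le_of_lt_edist π hG (lt_edist_localEdges (not_le.1 hnear))

/-- **CMM Theorem 5.3 for MAX 2LIN(2), pointwise form.**  A loopless edge set on `[n]` with maximum
degree `∆`, `l`-path-decomposable sub-edge-sets on `≤ √n` vertices and all cycles longer than `2L`,
with arbitrary edge weights `π`, admits a `d`-local pseudo-density giving every edge equation
`x_v = x_u ⊕ [π_uv = −1]` pseudo-probability `≥ 1 − ε` as soon as the parameters fit: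
`0 ≤ µ ≤ 1`, `0 < ε`, `40µ ≤ ε³`, `(1−µ)^L ≤ 1/2`, `9L ≤ l`, `2L < g ≤` every cycle length,
`2 ≤ d`, `d(1−µ)^L ≤ µ/2`, `(d(∆+1)^L)² ≤ n`.
[cite: CharikarMakarychevMakarychev2009, Thm 5.3 (p. 11) and Thm 6.1 proof (p. 13: "Theorem 5.3 works not only for MAX CUT, but also for MAX 2LIN"); LeeRaghavendraSteurer2015, §7.1 (arXiv p. 27)] -/
theorem exists_pseudoDensity_twoLin_of_gapGraph (E : Finset (Sym2 (Fin n)))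
    (hloop : ∀ e ∈ E, ¬ e.IsDiag) {Δ : ℕ} (hΔ : ∀ v : Fin n, (E.filter fun e => v ∈ e).card ≤ Δ)
    {l : ℕ} (hPD : ∀ E' ⊆ E, ((supp E').card : ℝ) ^ 2 ≤ n → PathDecomposable l E')
    {g : ℕ} (hgirth : ∀ (u : Fin n) (c : (gr E).Walk u u), c.IsCycle → g ≤ c.length)
    {μ : ℝ} (hμ0 : 0 ≤ μ) (hμ1 : μ ≤ 1) {ε : ℝ} (hε : 0 < ε) (hμε : 40 * μ ≤ ε ^ 3)
    {L : ℕ} (hq : (1 - μ) ^ L ≤ 1 / 2) (hl : 9 * L ≤ l) (hLg : 2 * L < g) {d : ℕ}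
    (hd : 2 ≤ d) (hη : (d : ℝ) * (1 - μ) ^ L ≤ μ / 2) (hfit : ((d * (Δ + 1) ^ L : ℕ) : ℝ) ^ 2 ≤ n)
    (π : Sym2 (Fin n) → Bool) :
    ∃ D : (Fin n → Bool) → ℝ, IsLocalPseudoDensity (uniformWeight (Fin n) Bool) d D ∧
      ∀ u v : Fin n, s(u, v) ∈ E → 1 - ε ≤ muExpect (uniformWeight (Fin n) Bool)
        (fun y => D y * (if y v = xor (y u) (π s(u, v)) then (1 : ℝ) else 0)) := by
  have hL : 1 ≤ L := L_pos hq
  have h1μ : 0 ≤ 1 - μ := by linarith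
  have hU : SignConsistent π E L := signConsistent_of_girth π hgirth hLg
  exact exists_pseudoDensity_twoLin_of_localCorrelations E hloop π (cmmTargetS π E μ L)
    (cmmTargetS_symm π μ hU) (cmmTargetS_diag π E μ L) hμ0 (pow_nonneg h1μ L) hε hμε
    (fun u v he => cmmTargetS_edge π μ hU hL he
      (fun h => hloop _ he (by subst h; exact Sym2.mk_isDiag_iff.2 rfl)))
    hd hη (cmm_hlocS π E hloop hΔ hμ0 hμ1 hq hl hPD hU hfit)

end Multicut

end Literature.Combinatorics.Optimization

end
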